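import Summits.Ventures.PercRepro.SeriesParallelC005

/-!
# C-005 for the subdivided `K₄` with paths of length two — a 12-edge graph, every `p`

A concrete instance of `C005At_of_reduces` (`SeriesParallelC005.lean`) beyond the ≤ 8-edge theorem:
the graph `subdividedK4Two` on the terminals `0, 1, 2, 3` and the six midpoints `4, …, 9`, with the
twelve edges `(i, m_{ij})`, `(m_{ij}, j)` — every edge of `K₄` subdivided once. Six series steps at
the (unmarked) midpoints reduce it to six live edges (`subdividedK4Two_reduces`), so C-005 holds
for it at every edge-weight vector (`C005At_subdividedK4Two`). The series conditions are decided
on the finite types; the dead edges after the chain are the six odd-numbered ones.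
-/

namespace PercRepro

namespace MultiGraph

/-- The subdivided `K₄`: terminals `0, 1, 2, 3`; midpoints `4 = m₀₁, 5 = m₀₂, 6 = m₀₃, 7 = m₁₂,
8 = m₁₃, 9 = m₂₃`; edge `2k` joins the first terminal of the `k`-th pair to its midpoint, edge
`2k + 1` the midpoint to the second terminal. -/
def subdividedK4Two : MultiGraph (Fin 10) (Fin 12) where
  fst := ![0, 4, 0, 5, 0, 6, 1, 7, 1, 8, 2, 9]
  snd := ![4, 1, 5, 2, 6, 3, 7, 2, 8, 3, 9, 3]

/-- The graph after the series steps at the midpoints `4, …, 9`: every even edge re-attached to its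
two terminals. -/
def subdividedK4Two.reduced : MultiGraph (Fin 10) (Fin 12) :=
  ((((((subdividedK4Two.seriesGraph 0 0 1).seriesGraph 2 0 2).seriesGraph 4 0 3).seriesGraph
    6 1 2).seriesGraph 8 1 3).seriesGraph 10 2 3)

/-- The weight after the six series steps. -/
noncomputable def subdividedK4Two.reducedWeight (p : Fin 12 → ℝ) : Fin 12 → ℝ :=
  serWeight (serWeight (serWeight (serWeight (serWeight (serWeight p 0 1) 2 3) 4 5) 6 7) 8 9) 10 11

/-- `IsSeries` is decidable on finite types. -/
instance {V E : Type} [DecidableEq V] [DecidableEq E] [Fintype E] (G : MultiGraph V E)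
    (e₁ e₂ : E) (x y z : V) : Decidable (G.IsSeries e₁ e₂ x y z) :=
  decidable_of_iff (e₁ ≠ e₂ ∧ ((G.fst e₁ = y ∧ G.snd e₁ = x) ∨ (G.fst e₁ = x ∧ G.snd e₁ = y)) ∧
      ((G.fst e₂ = x ∧ G.snd e₂ = z) ∨ (G.fst e₂ = z ∧ G.snd e₂ = x)) ∧ y ≠ x ∧ z ≠ x ∧
      ∀ e, G.fst e = x ∨ G.snd e = x → e = e₁ ∨ e = e₂)
    ⟨fun ⟨h1, h2, h3, h4, h5, h6⟩ => ⟨h1, h2, h3, h4, h5, h6⟩,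
     fun ⟨h1, h2, h3, h4, h5, h6⟩ => ⟨h1, h2, h3, h4, h5, h6⟩⟩

/-- The six series steps reduce the subdivided `K₄` to `reduced` at `reducedWeight`. -/
theorem subdividedK4Two_reduces (p : Fin 12 → ℝ) :
    Reduces (0 : Fin 10) 1 2 3 (subdividedK4Two, p)
      (subdividedK4Two.reduced, subdividedK4Two.reducedWeight p) := by
  unfold Reduces
  refine Relation.ReflTransGen.head (SPStep.series (e₁ := 0) (e₂ := 1) (x := 4) (y := 0) (z := 1) (by decide) (by decide)) ?_
  refine Relation.ReflTransGen.head (SPStep.series (e₁ := 2) (e₂ := 3) (x := 5) (y := 0) (z := 2) (by decide) (by decide)) ?_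
  refine Relation.ReflTransGen.head (SPStep.series (e₁ := 4) (e₂ := 5) (x := 6) (y := 0) (z := 3) (by decide) (by decide)) ?_
  refine Relation.ReflTransGen.head (SPStep.series (e₁ := 6) (e₂ := 7) (x := 7) (y := 1) (z := 2) (by decide) (by decide)) ?_
  refine Relation.ReflTransGen.head (SPStep.series (e₁ := 8) (e₂ := 9) (x := 8) (y := 1) (z := 3) (by decide) (by decide)) ?_
  refine Relation.ReflTransGen.head (SPStep.series (e₁ := 10) (e₂ := 11) (x := 9) (y := 2) (z := 3) (by decide) (by decide)) ?_
  exact Relation.ReflTransGen.refl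

/-- After the chain the odd edges are dead. -/
theorem subdividedK4Two.reducedWeight_odd (p : Fin 12 → ℝ) :
    ∀ e : Fin 12, e.val % 2 = 1 → subdividedK4Two.reducedWeight p e = 0 := by
  intro e he
  unfold subdividedK4Two.reducedWeight serWeight
  fin_cases e <;> simp at he ⊢

/-- At most six edges are live after the chain. -/
theorem subdividedK4Two.card_liveEdges_reducedWeight_le (p : Fin 12 → ℝ) :
    (liveEdges (subdividedK4Two.reducedWeight p)).card ≤ 8 := by
  classical
  have hsub : liveEdges (subdividedK4Two.reducedWeight p) ⊆
      Finset.univ.filter fun e : Fin 12 => e.val % 2 = 0 := by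
    intro e he
    rw [mem_liveEdges] at he
    refine Finset.mem_filter.2 ⟨Finset.mem_univ _, ?_⟩
    by_contra hodd
    have h1 : e.val % 2 = 1 := by omega
    exact he (subdividedK4Two.reducedWeight_odd p e h1)
  refine (Finset.card_le_card hsub).trans ?_
  decide

/-- **C-005 for the subdivided `K₄` with paths of length two, at every `p`**: a graph with twelve
edges, beyond the ≤ 8-edge theorem. -/
theorem C005At_subdividedK4Two (p : Fin 12 → ℝ) (hp : IsProb p) :
    subdividedK4Two.C005At p 0 1 2 3 :=
  C005At_of_reduces hp (subdividedK4Two_reduces p)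
    (subdividedK4Two.card_liveEdges_reducedWeight_le p)

end MultiGraph

end PercRepro
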